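import Literature.MathematicalPhysics.QuantumLattice.HubbardLangerMattisBound
import Literature.MathematicalPhysics.QuantumLattice.HubbardModelProofs
import Literature.MathematicalPhysics.QuantumLattice.ReducedBCSTorus
import Literature.MathematicalPhysics.QuantumLattice.HubbardEnergyDensityCertificateLimit
import Literature.Probability.LatticeModels.BrillouinRiemannSum
import Literature.Computability.AlgebraicComplexity.QuantumFunctionalSpectral
import HarnessLib

/-!
# The Langer–Mattis / Kennedy–Lieb bound on the torus and in the thermodynamic limit

Topic `MathematicalPhysics/QuantumLattice`, family `hubbard`. Sequel to `HubbardLangerMattisBound.lean`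
(the bound `E_G(N) ≥ (U/2)N - (U/4)|Λ| - Σ_i √(λ_i(tA_G)² + U²/16)` on every finite bipartite graph).
Here the graph is the discrete torus `(ℤ/Lℤ)^d` of the tree (`fermionTorusGraph d L`), and everything
is PROVED:

* `torusColour_bipartite` — for even `L` the torus is bipartite (colouring by the tree's staggering
  sign `torusStagger`, `torusStagger_eq_neg_of_adj_holds`);
* `sitePlaneWave`, `hopMatrix_mul_sitePlaneWave`, `charpoly_hopMatrix_torus`,
  `sum_eigenvalues_hopMatrix_torus` — the site plane waves `L^{-d/2} χ_k(x)` diagonalise the hopping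
  matrix `t A_{(ℤ/Lℤ)^d}` with levels `2t Σ_i cos(2πk_i/L)` (`L ≥ 3`), so every spectral sum
  `Σ_i f(λ_i)` is the momentum sum `Σ_k f(2t Σ_i cos(2πk_i/L))` (through the characteristic polynomial,
  `Literature.Computability.AlgebraicComplexity.sum_eigenvalues_eq_roots_sum`); in particular
  `langerMattisSum_torus`: `Σ_i √(λ_i² + U²/16) = Σ_k √(ε_k² + U²/16)`, `ε_k = 2t Σ_i cos(2πk_i/L)`
  [LangerMattis1971, eq. (3)];
* `hubbardTorus_groundEnergyAt_ge` — **Langer–Mattis on the even torus**: for `L` even, `L ≥ 3`,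
  all real `t, U` and `N ≤ 2L^d`,
  `E_L(N) ≥ (U/2)N - (U/4)L^d - Σ_{k ∈ (ℤ/Lℤ)^d} √(ε_k² + U²/16)`;
* `energyDensity2D_ge` — **the thermodynamic limit, d = 2** (`U ≥ 0`, `0 ≤ n < 2`):
  `e(t,U,n) = energyDensity2D t U n ≥ (U/2)n - U/4 - (2π)⁻² ∫_{[-π,π]²} √(4t²(cos p₁ + cos p₂)² + U²/16) dp`,
  Langer–Mattis' `E_A(U/2, 1)` at half filling `n = 1` [LangerMattis1971, eqs. (3)–(5) and Fig. 2
  ("Σ → ∫ρ(ε)dε")], through the even tori `L = 2m` (the limit exists along all `L`,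
  `tendsto_energyDensity2D_torus`) and the tree's Riemann-sum theorem `tendsto_cornerRiemannSum`
  (`sum_latticeMomentum_div_eq_cornerRiemannSum`, `lmIntegrand_add_pi`).

The only non-kernel step left for the printed Langer–Mattis NUMBERS (e.g. `e ≥ -1.0256` at `t = 1`,
`U = 4`, `n = 1`) is a certified quadrature of the explicit integral `∫ lmIntegrand`.

## References

* W. D. Langer, D. C. Mattis, Phys. Lett. 36A (1971) 139–140, eqs. (3)–(5). [LangerMattis1971]
* T. Kennedy, E. H. Lieb, Physica A 138 (1986) 320–358, Theorem 2.1. [KennedyLieb1986]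
* S. Friedli, Y. Velenik, *Statistical Mechanics of Lattice Systems* (CUP 2017), §10.5.2 (momentum
  sums as Riemann sums). [FriedliVelenikSMLS2017]

## Mathlib / tree search

Tree (REUSED): `LangerMattis.groundEnergyAt_ge/langerMattisSum/hopMatrix` (part 1),
`torusStagger_eq_neg_of_adj_holds`, `torusChar`, `torusFourierWeight`,
`sum_torusFourierWeight_mul_torusChar_mul_conj`, `sum_ite_torusGraph_adj_torusChar`,
`FermionTorus.sum_eq_sum_torusSite`, `latticeMomentum_eq_cellCorner_add`, `cornerRiemannSum`,
`tendsto_cornerRiemannSum`, `energyDensity2D`, `tendsto_energyDensity2D_torus`,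
`ThermodynamicLimit.tendsto_rectN_div_sq`, `rectN_le_two_mul`,
`Literature.Computability.AlgebraicComplexity.{sum_eigenvalues_eq_roots_sum, charpoly_conj_of_mul_eq_one,
roots_prod_X_sub_C_fun}`. Mathlib: `Matrix.charpoly_diagonal`, `Int.units_eq_one_or`,
`le_of_tendsto_of_tendsto`.
-/

noncomputable section

namespace Literature.MathematicalPhysics.QuantumLattice

namespace LangerMattis

open Matrix Finset Filter Polynomial Literature.Probability.LatticeModels ThermodynamicLimit
open scoped ComplexConjugate Topology

variable {d L : ℕ}

/-! ### The torus of even side is bipartite -/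

/-- The two-colouring of the fermionic torus by the staggering sign `ε_x = (-1)^{Σ xᵢ}`.
[cite: LiebPRL1989, Theorem 2 (bipartite lattice)] -/
def torusColour (x : FermionTorus d L) : Bool := decide (torusStagger x = 1)

/-- For even `L` the torus graph is properly two-coloured by `torusColour`.
[cite: LiebPRL1989, Theorem 2 (bipartite lattice)] -/
theorem torusColour_bipartite (hL : Even L) :
    ∀ x y : FermionTorus d L, (fermionTorusGraph d L).Adj x y → torusColour x ≠ torusColour y := by
  intro x y hxy h
  have hst := torusStagger_eq_neg_of_adj_holds hL hxy
  have h' : (torusStagger x = 1 ↔ torusStagger y = 1) := by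
    simpa [torusColour] using h
  rcases Int.units_eq_one_or (torusStagger y) with hy | hy
  · have hx := h'.2 hy
    rw [hx, hy] at hst
    exact absurd hst (by decide)
  · have hx : torusStagger x = 1 := by rw [hst, hy, neg_neg]
    have := h'.1 hx
    rw [hy] at this
    exact absurd this (by decide)

/-! ### Plane waves diagonalise the torus hopping matrix: spectral sums are momentum sums -/

section Spectral

variable [NeZero L]

variable (d L) in
/-- The site plane-wave matrix `W_{x,k} = L^{-d/2} χ_k(x)` on the fermionic torus (column `k` = the
normalised character of momentum `k`). [cite: FriedliVelenikSMLS2017, §10.5.2] -/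
def sitePlaneWave : Matrix (FermionTorus d L) (FermionTorus d L) ℂ :=
  Matrix.of fun x k => torusFourierWeight d L * torusChar k.toTorusSite x.toTorusSite

/-- `W Wᴴ = 1` (completeness of the characters). [folklore] -/
theorem sitePlaneWave_mul_conjTranspose : sitePlaneWave d L * (sitePlaneWave d L)ᴴ = 1 := by
  ext x y
  rw [Matrix.mul_apply, Matrix.one_apply, ← sum_torusFourierWeight_mul_torusChar_mul_conj x y,
    FermionTorus.sum_eq_sum_torusSite]
  refine Finset.sum_congr rfl fun z _ => ?_
  simp only [sitePlaneWave, conjTranspose_apply, Matrix.of_apply, FermionTorus.toTorusSite_ofTorusSite,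
    star_mul', star_torusFourierWeight, Complex.star_def]

/-- `Wᴴ W = 1`. [folklore] -/
theorem conjTranspose_sitePlaneWave_mul : (sitePlaneWave d L)ᴴ * sitePlaneWave d L = 1 :=
  mul_eq_one_comm.mp sitePlaneWave_mul_conjTranspose

/-- The hopping band read off a site index used as a momentum: `t · 2 Σ_i cos(2πk_i/L)`.
[cite: LangerMattis1971, eq. (3)] -/
def siteBand (t : ℝ) (k : FermionTorus d L) : ℝ :=
  t * (2 * ∑ i, Real.cos (latticeMomentum L k.toTorusSite i))

/-- **`(tA) W = W diag(ε)`**: the site plane waves are eigenvectors of the torus hopping matrix with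
levels `ε_k = 2t Σ_i cos(2πk_i/L)` (`L ≥ 3`). [cite: FriedliVelenikSMLS2017, §10.5.2] -/
theorem hopMatrix_mul_sitePlaneWave (hL : 3 ≤ L) (t : ℝ) :
    hopMatrix (fermionTorusGraph d L) t * sitePlaneWave d L =
      sitePlaneWave d L * diagonal (fun k => ((siteBand t k : ℝ) : ℂ)) := by
  ext x k
  rw [Matrix.mul_apply, mul_diagonal]
  simp only [hopMatrix, sitePlaneWave, Matrix.of_apply, fermionTorusGraph_adj, ite_mul, zero_mul]
  rw [FermionTorus.sum_eq_sum_torusSite]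
  simp only [FermionTorus.toTorusSite_ofTorusSite]
  have h2 : (∑ z : TorusSite d L, if (torusGraph d L).Adj x.toTorusSite z then
      (t : ℂ) * (torusFourierWeight d L * torusChar k.toTorusSite z) else 0) =
      (t : ℂ) * torusFourierWeight d L *
        ∑ z, (if (torusGraph d L).Adj x.toTorusSite z then torusChar k.toTorusSite z else 0) := by
    rw [Finset.mul_sum]
    refine Finset.sum_congr rfl fun z _ => ?_
    split_ifs <;> ring
  rw [h2, sum_ite_torusGraph_adj_torusChar hL k.toTorusSite x.toTorusSite, siteBand]
  push_cast
  ring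

/-- `tA = W diag(ε) Wᴴ`. [cite: FriedliVelenikSMLS2017, §10.5.2] -/
theorem hopMatrix_torus_eq_conj (hL : 3 ≤ L) (t : ℝ) :
    hopMatrix (fermionTorusGraph d L) t =
      sitePlaneWave d L * diagonal (fun k => ((siteBand t k : ℝ) : ℂ)) * (sitePlaneWave d L)ᴴ := by
  rw [← hopMatrix_mul_sitePlaneWave hL t, Matrix.mul_assoc, sitePlaneWave_mul_conjTranspose,
    Matrix.mul_one]

/-- The characteristic polynomial of the torus hopping matrix: `χ = ∏_k (X - ε_k)`. [folklore] -/
theorem charpoly_hopMatrix_torus (hL : 3 ≤ L) (t : ℝ) :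
    (hopMatrix (fermionTorusGraph d L) t).charpoly =
      ∏ k : FermionTorus d L, (X - C ((siteBand t k : ℝ) : ℂ)) := by
  rw [hopMatrix_torus_eq_conj hL t,
    Literature.Computability.AlgebraicComplexity.charpoly_conj_of_mul_eq_one _ _ _
      conjTranspose_sitePlaneWave_mul,
    Matrix.charpoly_diagonal]

/-- **Spectral sums of the torus hopping matrix are momentum sums**: for every `f : ℝ → ℝ` and
`L ≥ 3`, `Σ_i f(λ_i(tA_{(ℤ/Lℤ)^d})) = Σ_{k ∈ (ℤ/Lℤ)^d} f(2t Σ_i cos(2πk_i/L))`.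
[cite: FriedliVelenikSMLS2017, §10.5.2] -/
theorem sum_eigenvalues_hopMatrix_torus (hL : 3 ≤ L) (t : ℝ) (f : ℝ → ℝ) :
    ∑ i, f ((isHermitian_hopMatrix (fermionTorusGraph d L) t).eigenvalues i) =
      ∑ k : TorusSite d L, f (t * (2 * ∑ i, Real.cos (latticeMomentum L k i))) := by
  rw [Literature.Computability.AlgebraicComplexity.sum_eigenvalues_eq_roots_sum _ f,
    charpoly_hopMatrix_torus hL t,
    Literature.Computability.AlgebraicComplexity.roots_prod_X_sub_C_fun, Multiset.map_map,
    ← Finset.sum_eq_multiset_sum, FermionTorus.sum_eq_sum_torusSite]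
  refine Finset.sum_congr rfl fun z _ => ?_
  simp only [Function.comp_apply, RCLike.re_to_complex, Complex.ofReal_re, siteBand,
    FermionTorus.toTorusSite_ofTorusSite]

/-- **The Langer–Mattis constant of the torus is the momentum sum**
`Σ_k √(ε_k² + U²/16)`, `ε_k = 2t Σ_i cos(2πk_i/L)` (`L ≥ 3`). [cite: LangerMattis1971, eq. (3)] -/
theorem langerMattisSum_torus (hL : 3 ≤ L) (t U : ℝ) :
    langerMattisSum (fermionTorusGraph d L) t U =
      ∑ k : TorusSite d L,
        Real.sqrt ((t * (2 * ∑ i, Real.cos (latticeMomentum L k i))) ^ 2 + (U / 4) ^ 2) := by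
  rw [langerMattisSum]
  exact sum_eigenvalues_hopMatrix_torus hL t (fun x => Real.sqrt (x ^ 2 + (U / 4) ^ 2))

end Spectral

/-! ### Langer–Mattis on the even torus -/

/-- `|(ℤ/Lℤ)^d| = L^d` for the fermionic torus. [folklore] -/
theorem card_fermionTorus_eq : Fintype.card (FermionTorus d L) = L ^ d := by
  rw [Fintype.card_lex, Fintype.card_fun, Fintype.card_fin, Fintype.card_fin]

/-- **Langer–Mattis–Kennedy–Lieb bound on the even torus.** For `L` even, `L ≥ 3`, all real
`t, U` and `N ≤ 2L^d`:
`E_L(N) ≥ (U/2)N - (U/4)L^d - Σ_{k ∈ (ℤ/Lℤ)^d} √((2tΣ_i cos(2πk_i/L))² + U²/16)`.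
[cite: LangerMattis1971, eqs. (3)–(5)][cite: KennedyLieb1986, Theorem 2.1] -/
theorem hubbardTorus_groundEnergyAt_ge [NeZero L] (hL : Even L) (hL3 : 3 ≤ L) (t U : ℝ) {N : ℕ}
    (hN : N ≤ 2 * L ^ d) :
    U / 2 * N - (U / 4 * (L : ℝ) ^ d + ∑ k : TorusSite d L,
        Real.sqrt ((t * (2 * ∑ i, Real.cos (latticeMomentum L k i))) ^ 2 + (U / 4) ^ 2)) ≤
      groundEnergyAt (fermionTorusGraph d L) t U N := by
  have hcard : Fintype.card (FermionTorus d L) = L ^ d := card_fermionTorus_eq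
  have h := groundEnergyAt_ge (fermionTorusGraph d L) torusColour (torusColour_bipartite hL) t U
    (N := N) (by rw [hcard]; exact hN)
  rw [langerMattisSum_torus hL3, hcard] at h
  push_cast at h
  exact h

/-! ### The thermodynamic limit (d = 2) -/

/-- The Langer–Mattis integrand `√((2t Σ_i cos p_i)² + U²/16)` on the Brillouin zone.
[cite: LangerMattis1971, eq. (3)] -/
def lmIntegrand (t U : ℝ) (p : Fin d → ℝ) : ℝ :=
  Real.sqrt ((t * (2 * ∑ i, Real.cos (p i))) ^ 2 + (U / 4) ^ 2)

/-- The Langer–Mattis integrand is continuous. [folklore] -/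
theorem continuous_lmIntegrand (t U : ℝ) : Continuous (lmIntegrand (d := d) t U) := by
  have hs : Continuous fun p : Fin d → ℝ => ∑ i, Real.cos (p i) :=
    continuous_finsetSum _ fun i _ => Real.continuous_cos.comp (continuous_apply i)
  unfold lmIntegrand
  exact Real.continuous_sqrt.comp
    (((continuous_const.mul (continuous_const.mul hs)).pow 2).add continuous_const)

/-- The integrand is invariant under the shift `p ↦ p + (π,…,π)` (it only sees `(Σ cos p_i)²`).
[folklore] -/
theorem lmIntegrand_add_pi (t U : ℝ) (p : Fin d → ℝ) :
    lmIntegrand t U (p + fun _ => Real.pi) = lmIntegrand t U p := by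
  simp only [lmIntegrand, Pi.add_apply, Real.cos_add_pi, Finset.sum_neg_distrib, mul_neg, neg_sq]

/-- **Momentum averages are corner Riemann sums**: for a `(π,…,π)`-periodic `F`,
`L^{-d} Σ_{k ∈ (ℤ/Lℤ)^d} F(2πk/L) = (2π)^{-d} · cornerRiemannSum F L`.
[cite: FriedliVelenikSMLS2017, §10.5.2] -/
theorem sum_latticeMomentum_div_eq_cornerRiemannSum [NeZero L] (F : (Fin d → ℝ) → ℝ)
    (hF : ∀ p, F (p + fun _ => Real.pi) = F p) :
    (∑ k : TorusSite d L, F (latticeMomentum L k)) / (L : ℝ) ^ d =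
      ((2 * Real.pi) ^ d)⁻¹ * cornerRiemannSum F L := by
  have hL : (0 : ℝ) < L := by exact_mod_cast Nat.pos_of_ne_zero (NeZero.ne L)
  have hπ : (0 : ℝ) < 2 * Real.pi := by positivity
  rw [cornerRiemannSum_eq]
  simp_rw [smul_eq_mul]
  rw [← Finset.mul_sum, gridStep]
  have hsum : ∑ k : TorusSite d L, F (latticeMomentum L k) = ∑ k : TorusSite d L, F (cellCorner k) := by
    refine Finset.sum_congr rfl fun k _ => ?_
    rw [latticeMomentum_eq_cellCorner_add, hF]
  rw [hsum, div_pow, div_eq_iff (pow_ne_zero _ hL.ne'), mul_assoc, mul_comm _ ((L : ℝ) ^ d),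
    ← mul_assoc, ← mul_assoc]
  field_simp

/-- **Langer–Mattis in the thermodynamic limit (square lattice).** For `U ≥ 0` and every density
`0 ≤ n < 2`,

  `energyDensity2D t U n ≥ (U/2) n - U/4 - (2π)⁻² ∫_{[-π,π]²} √((2t(cos p₁ + cos p₂))² + U²/16) dp`;

at half filling `n = 1` the right-hand side is Langer–Mattis' `E_A(U/2, 1)` per site. Obtained from
`hubbardTorus_groundEnergyAt_ge` along the even tori `L = 2m` (bipartite), the existence of the
limit along all `L` (`tendsto_energyDensity2D_torus`), `N_L(n)/L² → n` and the convergence of the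
momentum Riemann sums (`tendsto_cornerRiemannSum`). (`U ≥ 0` is only used for the existence of the
limit defining `energyDensity2D`.) [cite: LangerMattis1971, eqs. (3)–(5)][cite: KennedyLieb1986, Theorem 2.1] -/
theorem energyDensity2D_ge (t : ℝ) {U : ℝ} (hU : 0 ≤ U) {n : ℝ} (hn0 : 0 ≤ n) (hn2 : n < 2) :
    U / 2 * n - U / 4 - ((2 * Real.pi) ^ 2)⁻¹ * ∫ p in brillouin 2, lmIntegrand t U p ≤
      energyDensity2D t U n := by
  -- the even tori `L = 2(m+2)`
  set φ : ℕ → ℕ := fun m => 2 * (m + 2) with hφdef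
  have hφ : Tendsto φ atTop atTop :=
    tendsto_atTop_atTop.2 fun b => ⟨b, fun m hm => by simp only [hφdef]; omega⟩
  have hlim : Tendsto (fun m => groundEnergyAt (fermionTorusGraph 2 (φ m)) t U (rectN n (φ m)) /
      ((φ m : ℕ) : ℝ) ^ 2) atTop (𝓝 (energyDensity2D t U n)) :=
    (tendsto_energyDensity2D_torus t hU hn0 hn2).comp hφ
  -- the lower bounds converge to the Langer–Mattis constant
  have hF : ContinuousOn (lmIntegrand (d := 2) t U) (brillouin 2) :=
    (continuous_lmIntegrand t U).continuousOn
  have hRS : Tendsto (fun m => ((2 * Real.pi) ^ 2)⁻¹ * cornerRiemannSum (lmIntegrand (d := 2) t U) (φ m))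
      atTop (𝓝 (((2 * Real.pi) ^ 2)⁻¹ * ∫ p in brillouin 2, lmIntegrand t U p)) :=
    ((tendsto_cornerRiemannSum hF).comp hφ).const_mul _
  have hN : Tendsto (fun m => U / 2 * ((rectN n (φ m) : ℝ) / ((φ m : ℕ) : ℝ) ^ 2)) atTop
      (𝓝 (U / 2 * n)) :=
    ((tendsto_rectN_div_sq hn0).comp hφ).const_mul _
  have hb : Tendsto (fun m => U / 2 * ((rectN n (φ m) : ℝ) / ((φ m : ℕ) : ℝ) ^ 2) - U / 4 -
      ((2 * Real.pi) ^ 2)⁻¹ * cornerRiemannSum (lmIntegrand (d := 2) t U) (φ m)) atTop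
      (𝓝 (U / 2 * n - U / 4 - ((2 * Real.pi) ^ 2)⁻¹ * ∫ p in brillouin 2, lmIntegrand t U p)) :=
    (hN.sub_const _).sub hRS
  refine le_of_tendsto_of_tendsto hb hlim (Eventually.of_forall fun m => ?_)
  -- the finite-volume inequality on the torus of side `L = 2(m+2)`, divided by `L²`
  dsimp only
  have hL3 : 3 ≤ φ m := by simp only [hφdef]; omega
  haveI : NeZero (φ m) := ⟨by omega⟩
  have hL2 : (0 : ℝ) < ((φ m : ℕ) : ℝ) ^ 2 := by
    have hLpos : (0 : ℝ) < ((φ m : ℕ) : ℝ) := by exact_mod_cast (show 0 < φ m by omega)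
    positivity
  have hNle : rectN n (φ m) ≤ 2 * φ m ^ 2 := by
    have := rectN_le_two_mul hn0 hn2.le (φ m)
    rwa [sq]
  have h : U / 2 * (rectN n (φ m) : ℝ) - (U / 4 * ((φ m : ℕ) : ℝ) ^ 2 +
      ∑ k : TorusSite 2 (φ m), lmIntegrand t U (latticeMomentum (φ m) k)) ≤
      groundEnergyAt (fermionTorusGraph 2 (φ m)) t U (rectN n (φ m)) :=
    hubbardTorus_groundEnergyAt_ge (d := 2) (even_two_mul _) hL3 t U hNle
  have havg := sum_latticeMomentum_div_eq_cornerRiemannSum (d := 2) (L := φ m) (lmIntegrand t U)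
    (lmIntegrand_add_pi t U)
  rw [← havg, le_div_iff₀ hL2]
  have key : (U / 2 * ((rectN n (φ m) : ℝ) / ((φ m : ℕ) : ℝ) ^ 2) - U / 4 -
      (∑ k : TorusSite 2 (φ m), lmIntegrand t U (latticeMomentum (φ m) k)) / ((φ m : ℕ) : ℝ) ^ 2) *
        ((φ m : ℕ) : ℝ) ^ 2 =
      U / 2 * (rectN n (φ m) : ℝ) - (U / 4 * ((φ m : ℕ) : ℝ) ^ 2 +
        ∑ k : TorusSite 2 (φ m), lmIntegrand t U (latticeMomentum (φ m) k)) := by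
    field_simp
    ring
  rw [key]
  exact h

end LangerMattis

end Literature.MathematicalPhysics.QuantumLattice
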